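import Summits.CriticalPhenomena.PercolationContinuityZ3.Theorems.PercNearOneGluingAdditiveGluingThreeTieFormAssembly
import HarnessLib

/-! # Crux `PercNearOneGluing.AdditiveGluing` (stmt-CriticalPhenomena-4576): the HYPOTHESIS-FREE glued-pair gain inequality (C_a)
# implies the glued-pair exchange (T-d), hence `AdditiveGluing` modulo (C_a) and the tie instances with ≥ 4 relays

Support file (`--supports stmt-CriticalPhenomena-4576`, lead prim-png-lead-4576).  No definitions, no named facts, no sorries.
Notation as in `PercNearOneGluingAdditiveGluingGluedPairReduction`: `W = {a₁,a₃}`, `N₂ = {a₂↮a₁}∩{a₂↮a₃}`, `α̃ = μ(N₂∩O_W)`,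
`β̃ = μ(N₂∩O₂)`, `Gain(x) = μ({x↮b} ∩ ({x↔a₁}∩{a₃↔b} ∪ {x↔a₃}∩{a₁↔b}))` (the probability that `x` is joined to `b` only after gluing
`W`), `π_x = μ(a₁↔b, a₃↮b)`, `π_x' = μ(a₃↔b, a₁↮b)`.
**(C_a) — glued-pair gain inequality (registered stub `stub_gluedPairGain_pl`, NO hypotheses):**
  `(α̃+β̃)·Gain(o) ≤ α̃·max(π_x, π_x') + β̃·Gain(a₂)`,
i.e. `o`'s gain from gluing `W` is at most the mixture of the trivial bound `max(π_x,π_x')` and of `a₂`'s gain, with mixture weights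
`o`'s attachment to `W` resp. to `a₂` in the world where `a₂` is cut from `W`.  Exact at `o = a₂` and at `o ∈ W`; 0 violations in
6·10⁴ random instances and in seeded adversarial search (lead lab t47/t48); no certificate of degree ≤ 3 from Harris/BHK-set atoms was found
(lab/tdlp), so a proof needs a new idea (BHK-type induction?).  On the tie locus `π_x = π_x'`, and since `τ₂ ≥ τ₃` and the rooms are
nonnegative, (C_a) implies (T-d) (`gluedPairExchange_of_gluedPairGain`); hence `additiveGluing_of_gluedPairGain_and_four`.
[cite: KozmaNitzan2024, Theorem 1 (§3.1), §5.3 (p. 34)]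
-/

namespace Summit.CriticalPhenomena.PercolationContinuityZ3.Theorems

open MeasureTheory Set Literature.Probability.LatticeModels Literature.Probability.Percolation

noncomputable section
open Classical

/-- **(C_a) ⟹ (T-d)** on the tie locus: with `τ₁ = τ₃` one has `π_x = π_x'` (both equal `τ₃ − μ(a₁↔b ∧ a₃↔b)`), and the extra terms of
(T-d) — the rooms `R_W, R₂'` and `τ₂ − τ₃` — are nonnegative. [folklore] -/
theorem gluedPairExchange_of_gluedPairGain
    (hCA : ∀ (n : ℕ) (w : Sym2 (Fin n) → unitInterval) (o b a₁ a₂ a₃ : Fin n), ((prodBernoulli w).real ((openConn a₂ a₁)ᶜ ∩ (openConn a₂ a₃)ᶜ ∩ (openConn o a₁ ∪ openConn o a₃)) + (prodBernoulli w).real ((openConn a₂ a₁)ᶜ ∩ (openConn a₂ a₃)ᶜ ∩ openConn o a₂)) * (prodBernoulli w).real ((openConn o b)ᶜ ∩ (openConn o a₁ ∩ openConn a₃ b ∪ openConn o a₃ ∩ openConn a₁ b)) ≤ (prodBernoulli w).real ((openConn a₂ a₁)ᶜ ∩ (openConn a₂ a₃)ᶜ ∩ (openConn o a₁ ∪ openConn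 o a₃)) * max ((prodBernoulli w).real (openConn a₁ b ∩ (openConn a₃ b)ᶜ)) ((prodBernoulli w).real (openConn a₃ b ∩ (openConn a₁ b)ᶜ)) + (prodBernoulli w).real ((openConn a₂ a₁)ᶜ ∩ (openConn a₂ a₃)ᶜ ∩ openConn o a₂) * (prodBernoulli w).real ((openConn a₂ b)ᶜ ∩ (openConn a₂ a₁ ∩ openConn a₃ b ∪ openConn a₂ a₃ ∩ openConn a₁ b))) :
    ∀ (n : ℕ) (w : Sym2 (Fin n) → unitInterval) (o b a₁ a₂ a₃ : Fin n), a₁ ≠ a₂ → a₁ ≠ a₃ → a₂ ≠ a₃ → (prodBernoulli w).real (openConn a₃ b) ≤ (prodBernoulli w).real (openConn a₁ b) → (prodBernoulli w).real (openConn a₃ b) ≤ (prodBernoulli w).real (openConn a₂ b) → (prodBernoulli w).real (openConn a₁ b) ≤ (prodBernoulli w).real (openConn a₃ b) → (prodBernoulli w).real (openConn o b) < (prodBernoulli w).real (openConn a₃ b) → (prodBernoulli w).real ((openConn a₁ a₃)ᶜ ∩ (openConn a₂ a₃)ᶜ ∩ (openConn a₁ b ∩ openConn a₂ b)) < (prodBernoulli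 w).real ((openConn a₁ a₃)ᶜ ∩ (openConn a₂ a₃)ᶜ ∩ openConn a₃ b) → ((prodBernoulli w).real ((openConn a₂ a₁)ᶜ ∩ (openConn a₂ a₃)ᶜ ∩ (openConn o a₁ ∪ openConn o a₃)) + (prodBernoulli w).real ((openConn a₂ a₁)ᶜ ∩ (openConn a₂ a₃)ᶜ ∩ openConn o a₂)) * (prodBernoulli w).real ((openConn o b)ᶜ ∩ (openConn o a₁ ∩ openConn a₃ b ∪ openConn o a₃ ∩ openConn a₁ b)) ≤ (prodBernoulli w).real ((openConn a₂ a₁)ᶜ ∩ (openConn a₂ a₃)ᶜ ∩ (openConn o a₁ ∪ openConn o a₃)) * ((prodBernoulli w).real (openConn a₁ b ∩ (openConn a₃ b)ᶜ) + (prodBernoulli w).real ((openConn a₁ b)ᶜ ∩ (openConn a₃ b)ᶜ ∩ (openConn o a₁ ∪ openConn o a₂ ∪ openConn o a₃)ᶜ)) + (prodBernoulli w).real ((openConn a₂ a₁)ᶜ ∩ (openConn a₂ a₃)ᶜ ∩ openConn o a₂) * (((prodBernoulli w).real (openConn a₂ b) - (prodBernoulli w).real (openConn a₃ b)) + (prodBernoulli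 w).real ((openConn a₂ b)ᶜ ∩ (openConn a₂ a₁ ∩ openConn a₃ b ∪ openConn a₂ a₃ ∩ openConn a₁ b)) + (prodBernoulli w).real ((openConn a₂ b)ᶜ ∩ ((openConn a₂ a₁ ∪ openConn a₂ a₃) ∩ (openConn a₁ b ∪ openConn a₃ b))ᶜ ∩ (openConn o a₁ ∪ openConn o a₂ ∪ openConn o a₃)ᶜ)) := by
  intro n w o b a₁ a₂ a₃ h12 h13 h23 hτ31 hτ32 htie hob hgood
  have hm : ∀ s : Set (BondConfig (Fin n)), MeasurableSet s := fun _ => MeasurableSet.of_discrete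
  have h := hCA n w o b a₁ a₂ a₃
  -- `π_x = π_x'` at the tie
  have e1 := measureReal_inter_add_sdiff (μ := prodBernoulli w) (s := (openConn a₁ b : Set (BondConfig (Fin n)))) (hm (openConn a₃ b))
  have e3 := measureReal_inter_add_sdiff (μ := prodBernoulli w) (s := (openConn a₃ b : Set (BondConfig (Fin n)))) (hm (openConn a₁ b))
  have ecomm : (openConn a₃ b : Set (BondConfig (Fin n))) ∩ openConn a₁ b = openConn a₁ b ∩ openConn a₃ b := Set.inter_comm _ _
  rw [ecomm] at e3
  have d1 : ((openConn a₁ b : Set (BondConfig (Fin n))) \ openConn a₃ b) = openConn a₁ b ∩ (openConn a₃ b)ᶜ := Set.sdiff_eq _ _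
  have d3 : ((openConn a₃ b : Set (BondConfig (Fin n))) \ openConn a₁ b) = openConn a₃ b ∩ (openConn a₁ b)ᶜ := Set.sdiff_eq _ _
  rw [d1] at e1
  rw [d3] at e3
  have hτ13 : (prodBernoulli w).real (openConn a₁ b : Set (BondConfig (Fin n))) = (prodBernoulli w).real (openConn a₃ b) :=
    le_antisymm htie hτ31
  have hpieq : (prodBernoulli w).real (openConn a₁ b ∩ (openConn a₃ b)ᶜ : Set (BondConfig (Fin n))) =
      (prodBernoulli w).real (openConn a₃ b ∩ (openConn a₁ b)ᶜ : Set (BondConfig (Fin n))) := by linarith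
  have hmax : max ((prodBernoulli w).real (openConn a₁ b ∩ (openConn a₃ b)ᶜ : Set (BondConfig (Fin n))))
      ((prodBernoulli w).real (openConn a₃ b ∩ (openConn a₁ b)ᶜ : Set (BondConfig (Fin n)))) =
      (prodBernoulli w).real (openConn a₁ b ∩ (openConn a₃ b)ᶜ : Set (BondConfig (Fin n))) := by
    rw [← hpieq, max_self]
  rw [hmax] at h
  have hα : 0 ≤ (prodBernoulli w).real ((openConn a₂ a₁)ᶜ ∩ (openConn a₂ a₃)ᶜ ∩ (openConn o a₁ ∪ openConn o a₃) : Set (BondConfig (Fin n))) :=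
    measureReal_nonneg
  have hβ : 0 ≤ (prodBernoulli w).real ((openConn a₂ a₁)ᶜ ∩ (openConn a₂ a₃)ᶜ ∩ openConn o a₂ : Set (BondConfig (Fin n))) :=
    measureReal_nonneg
  have hRW : 0 ≤ (prodBernoulli w).real ((openConn a₁ b)ᶜ ∩ (openConn a₃ b)ᶜ ∩ (openConn o a₁ ∪ openConn o a₂ ∪ openConn o a₃)ᶜ :
      Set (BondConfig (Fin n))) := measureReal_nonneg
  have hR2 : 0 ≤ (prodBernoulli w).real ((openConn a₂ b)ᶜ ∩ ((openConn a₂ a₁ ∪ openConn a₂ a₃) ∩ (openConn a₁ b ∪ openConn a₃ b))ᶜ ∩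
      (openConn o a₁ ∪ openConn o a₂ ∪ openConn o a₃)ᶜ : Set (BondConfig (Fin n))) := measureReal_nonneg
  have h23' : 0 ≤ (prodBernoulli w).real (openConn a₂ b : Set (BondConfig (Fin n))) - (prodBernoulli w).real (openConn a₃ b : Set (BondConfig (Fin n))) := by
    linarith
  nlinarith [mul_nonneg hα hRW, mul_nonneg hβ hR2, mul_nonneg hβ h23']

/-- **`AdditiveGluing` from the glued-pair gain inequality (C_a) and the tie instances with at least four relays.**
[cite: KozmaNitzan2024, Theorem 1 (§3.1), §5.3 (p. 34)] -/
theorem additiveGluing_of_gluedPairGain_and_four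
    (hCA : ∀ (n : ℕ) (w : Sym2 (Fin n) → unitInterval) (o b a₁ a₂ a₃ : Fin n), ((prodBernoulli w).real ((openConn a₂ a₁)ᶜ ∩ (openConn a₂ a₃)ᶜ ∩ (openConn o a₁ ∪ openConn o a₃)) + (prodBernoulli w).real ((openConn a₂ a₁)ᶜ ∩ (openConn a₂ a₃)ᶜ ∩ openConn o a₂)) * (prodBernoulli w).real ((openConn o b)ᶜ ∩ (openConn o a₁ ∩ openConn a₃ b ∪ openConn o a₃ ∩ openConn a₁ b)) ≤ (prodBernoulli w).real ((openConn a₂ a₁)ᶜ ∩ (openConn a₂ a₃)ᶜ ∩ (openConn o a₁ ∪ openConn o a₃)) * max ((prodBernoulli w).real (openConn a₁ b ∩ (openConn a₃ b)ᶜ)) ((prodBernoulli w).real (openConn a₃ b ∩ (openConn a₁ b)ᶜ)) + (prodBernoulli w).real ((openConn a₂ a₁)ᶜ ∩ (openConn a₂ a₃)ᶜ ∩ openConn o a₂) * (prodBernoulli w).real ((openConn a₂ b)ᶜ ∩ (openConn a₂ a₁ ∩ openConn a₃ b ∪ openConn a₂ a₃ ∩ openConn a₁ b)))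
    (hFour : ∀ (n : ℕ) (w : Sym2 (Fin n) → unitInterval) (A : Finset (Fin n)) (o b : Fin n) (t : ℝ), 4 ≤ (A.erase b).card → (∃ a ∈ A, ∃ a' ∈ A, a ≠ a' ∧ (prodBernoulli w).real (openConn a b) = (prodBernoulli w).real (openConn a' b) ∧ ∀ c ∈ A, (prodBernoulli w).real (openConn a b) ≤ (prodBernoulli w).real (openConn c b)) → 0 ≤ t → (∀ a ∈ A, 1 - t ≤ (prodBernoulli w).real (openConn a b)) → (prodBernoulli w).real (⋃ a ∈ A, openConn o a) - t ≤ (prodBernoulli w).real (openConn o b)) :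
    Summit.CriticalPhenomena.PercolationContinuityZ3.Theses.PercNearOneGluing.AdditiveGluing :=
  additiveGluing_of_gluedPairExchange_and_four (gluedPairExchange_of_gluedPairGain hCA) hFour

end

end Summit.CriticalPhenomena.PercolationContinuityZ3.Theorems
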